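import Summits.CriticalPhenomena.PercolationContinuityZ3.Theorems.Transplant.TwoAxisParaCellsFineFrame
import Summits.CriticalPhenomena.PercolationContinuityZ3.Theorems.Transplant.SkelPhiFaceStepNS
import Summits.CriticalPhenomena.PercolationContinuityZ3.Theorems.Transplant.SkelPhiFaceStepN
import Summits.CriticalPhenomena.PercolationContinuityZ3.Theorems.Transplant.SkelPhiWinStep
import Summits.CriticalPhenomena.PercolationContinuityZ3.Theorems.Transplant.SkelPhiFaceDataN
import Literature.Probability.Percolation.OrientedHistorySiteRenormalizationRun
import Summits.CriticalPhenomena.PercolationContinuityZ3.Theorems.Transplant.SkelPhiCellsWeakGLevelsS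
import Summits.CriticalPhenomena.PercolationContinuityZ3.Theorems.Transplant.SkelPhiCellsWeakGS
import Summits.CriticalPhenomena.PercolationContinuityZ3.Theorems.Transplant.SkelPhiFaceRegionNS
import Summits.CriticalPhenomena.PercolationContinuityZ3.Theorems.Transplant.PlanarCells2SDefs
import HarnessLib
/-!
# N2 (frames-only node `SamePDropOfSkeletonFrm₁`, OPEN) — WAVE 1, (F) face-data column over STAGGERED cells ((R-22) `PCells2S`, (R-28)(β) one landing per file): the twin of N1's `SkelPhiFaceDataN`

builds on p205010 (kernel theorem, internal audit signed; external expert review pending) — nothing in this file uses p205010; NOTHING is claimed about the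
open node `SamePDropOfSkeletonFrm₁` (`SamePDropOfSkeletonNeg₁` is CLOSED in the tree and untouched by this file).
Status sentence (coordinator 2026-08-20T04:30Z): "θ(p_c) = 0 on ℤ^d, all d ≥ 2 — kernel-verified (Lean 4/Mathlib, standard axioms); internal adversarial
audit SIGNED 2026-08-20 04:29Z; external expert review pending."
Lane `prim-bschramm`, seat `prim-hp-8` (gen 40); helper file (`--supports stmt-CriticalPhenomena-4575 --as helper`); design owner p3-g15 ((R-22) staggered
cells `PCells2S`, (R-27)/(R-29) far regions of record `FarNS/FarNS₂`, (R-28)(β), naming 2026-08-22T23:00:04Z: suffix `S`).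
PORT RULES (HOME/prim-hp-8/code/gen40/orient/bin/port_s.py = stmt-g19's port_orient.py + the G token table): the cells are `P : PCells2S`, every box is
read about the STAGGERED centre `cenS` (`PlanarCells2SDefs/SFar/ContainS/SArm/SepS/SepInfS/LevelsS/EfarN2S`), the scheme record is `cellGeomSG₂S`/`cellGeomSG₂bS`
(`SkelPhiCellsWeakGS/…SmallMS`: narrow arm `BtwNS`, two-block far region `FarNS₂`), the history-site API is the ORIENTED one at `qNE` where it occurs
(`ochoice qNE`, `onwardO`, `Valid₂O`, `IsRun₂O`, …, (R-18)); EVERY declaration is re-declared with the suffix `S` (same namespace). Docstrings/citations are N1's.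
N1 HEADER (kept for the reader):
* §1 planar: `PCells2.faceCen`, `faceExt`, `faceLo_fst_eq_faceHi_fst`, `eq_faceCen_fst_of_mem_faceRow`, `abs_sub_faceCen_le`, `faceCen_mem_faceRow`;
* §2 `loN/hiN/DplN/faceStepWN`, `faceStepWN_Rg/_root/_T`, **`stepRgN_subset_Win`** (region ⊆ cell-map window), **`mem_stepRgN_of_cells`** /
  **`Win_subset_stepRgN`** (cell-controlled sets lie in the region: drift `k₀` of one frame point, `read_oth_of_frame_eq`), **`M_subset_stepRgN`**
  (`3r⊥ + k₀ + 3 ≤ 5r⊥`), `faceStepWN_T_subset_Rg`, `faceStepWN_T_sdiff_subset`, **`faceStepWN_encl`** (forward reading against `yF`: room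
  `Mabs(aw+Rlev+1) + rdN(Rlev+2)D ≤ rdK·kF·D`, `kF + 3 ≤ 5r⊥`, `Rlev + 4 ≤ 10 s∥, 3 r⊥`), **`Face_subset_faceStepWN_X_zero`** (inverse reading
  against `yF`: room `(rdK 1 b(e₀+1) + rdK 0 b(e₁+1))D ≤ Mabs(aw+1)`, `e = faceExt`), `faceStepWN_T_nonempty`, `M_nonempty_of_vertex`, `loN_hiN_hwide`;
* the clauses that need the history (subbox, support, root, planar diameter, rim excess) are in part 3b `SkelPhiFaceDataNHist`.
[cite: KozmaNitzan2024, §4 p. 27 ((30)), p. 30 (Step III), Lemma 10 (p. 17), Lemma 12 (p. 24)] [cite: MartineauTassion2017, §4.1]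
-/
noncomputable section

open MeasureTheory
open scoped Classical

namespace Summit.CriticalPhenomena.PercolationContinuityZ3.Theorems.Transplant

open Literature.Probability.Percolation Literature.Probability.LatticeModels SimpleGraph KNCells KNLevels GadgetSystem Contour
open Literature.Probability.Percolation.KozmaNitzan
open Literature.Probability.Percolation.KozmaNitzan.Cells (oth oth_ne sgOf sgOf_sign stepVec_apply_fst stepVec_apply_oth eq_oth_of_ne oth_oth)
open Literature.Barriers.CriticalPhenomena (graphBall graphBall_finite mem_graphBall_self graphBall_mono)
open BoxProdZ2 (ConcRadiiG mem_graphBall_succ_of_adj)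
open PCells (mem_psBox_iff)

/-! ## §1 Planar: the centre of the shifted face row and its extents -/

namespace PCells2S

variable (P : PCells2S)

/-- **The centre point of the shifted face row `F^{j+1}`**: the face level on axis `du.1`, the column centre across. [this work] -/
def faceCen (x : Site 2) (du : MDir) (j : ℕ) : Site 2 := fun k => if k = du.1 then P.faceLo x du j k else P.cenS x k

/-- **The extents of the face row about its centre**: `0` along the axis, `2 r⊥` across. [this work] -/
def faceExt (du : MDir) : Site 2 := fun k => if k = du.1 then 0 else 2 * (P.r (oth du.1) : ℤ)

/-- `faceCen` on the axis. [folklore] -/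
theorem faceCen_apply_fst (x : Site 2) (du : MDir) (j : ℕ) : ((P.faceCen x du j du.1 = P.faceLo x du j du.1) : Prop) := by simp [faceCen]

/-- `faceCen` across. [folklore] -/
theorem faceCen_apply_oth (x : Site 2) (du : MDir) (j : ℕ) : P.faceCen x du j (oth du.1) = P.cenS x (oth du.1) := by
  simp [faceCen, oth_ne]

/-- The face row has extent `0` along the axis: `faceLo du.1 = faceHi du.1`. [folklore] -/
theorem faceLo_fst_eq_faceHi_fst (x : Site 2) (du : MDir) (j : ℕ) : ((P.faceLo x du j du.1 = P.faceHi x du j du.1) : Prop) := by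
  simp only [faceLo, faceHi, sLo, sHi, if_true]

/-- A point of the face row has the face level on the axis. [folklore] -/
theorem eq_faceCen_fst_of_mem_faceRow {x : Site 2} {du : MDir} {j : ℕ} {t : Site 2}
    (ht : t ∈ Finset.Icc (P.faceLo x du j) (P.faceHi x du j)) : ((t du.1 = P.faceCen x du j du.1) : Prop) := by
  rw [faceCen_apply_fst]
  rw [Finset.mem_Icc] at ht
  have h1 := ht.1 du.1
  have h2 := ht.2 du.1
  rw [← faceLo_fst_eq_faceHi_fst] at h2
  exact le_antisymm h2 h1

/-- A point of the face row is within `faceExt` of the centre in every coordinate. [folklore] -/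
theorem abs_sub_faceCen_le {x : Site 2} {du : MDir} {j : ℕ} {t : Site 2} (ht : t ∈ Finset.Icc (P.faceLo x du j) (P.faceHi x du j))
    (k : Fin 2) : ((|t k - P.faceCen x du j k| ≤ P.faceExt du k) : Prop) := by
  by_cases hk : k = du.1
  · subst hk; rw [P.eq_faceCen_fst_of_mem_faceRow ht, sub_self, abs_zero]; simp [faceExt]
  · rw [eq_oth_of_ne hk, faceCen_apply_oth]
    rw [Icc_faceLo_faceHi, mem_psBox_iff] at ht
    simp only [faceExt, if_neg (oth_ne du.1)]
    exact abs_le.2 ⟨by linarith [ht.2.1], by linarith [ht.2.2]⟩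

/-- The centre lies in the face row. [folklore] -/
theorem faceCen_mem_faceRow (x : Site 2) (du : MDir) (j : ℕ) : ((P.faceCen x du j ∈ Finset.Icc (P.faceLo x du j) (P.faceHi x du j)) : Prop) := by
  rw [Finset.mem_Icc]
  constructor <;> intro k <;> by_cases hk : k = du.1
  · subst hk; simp [faceCen]
  · simp only [faceCen, if_neg hk, faceLo, sLo]; linarith [P.one_le_r (oth du.1)]
  · subst hk; simp [faceCen, faceLo_fst_eq_faceHi_fst]
  · simp only [faceCen, if_neg hk, faceHi, sHi]; linarith [P.one_le_r (oth du.1)]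

end PCells2S

namespace Skelφ

open Skel (winGraph WinStepData excess)

variable {V : Type} [DecidableEq V] (G : SimpleGraph V) [G.LocallyFinite]
variable (pr : FinePrm) (φ : V → Site 2) (P : PCells2S) (w₀ : V) (Λ : ConcRadiiG) (b : Fin 2)

/-! ## §2 The window target step of the face `(x, du, j)` at anchor `a'` over the frame `pr.frame φ w₀ du.1 b` -/

/-- Lower corner of the face box in frame coordinates: the face level on axis `du.1`, `pc − aw` on the raw axis. [this work] -/
def loNS (P : PCells2S) (x : Site 2) (du : MDir) (j : ℕ) (pc : ℤ) (aw : ℕ) : Site 2 := fun k => if k = du.1 then P.faceLo x du j k else pc - aw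

/-- Upper corner of the face box in frame coordinates. [this work] -/
def hiNS (P : PCells2S) (x : Site 2) (du : MDir) (j : ℕ) (pc : ℤ) (aw : ℕ) : Site 2 := fun k => if k = du.1 then P.faceHi x du j k else pc + aw

/-- **The planar region of the face step in frame coordinates (semantic)**: the frame points of the enlarged face box and of the radius box all of
whose vertices in `B_G(w₀, rE)` have cell point in `farAS₂ x du j`. [this work] -/
def DplNS (a' : ℕ) (x : Site 2) (du : MDir) (j : ℕ) (pc : ℤ) (aw Rlev : ℕ) : Finset (Site 2) :=
  (Finset.Icc (loNS P x du j pc aw - ((Rlev + 1 : ℕ) : Site 2)) (hiNS P x du j pc aw + ((Rlev + 1 : ℕ) : Site 2)) ∪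
      Finset.Icc (-((Λ.rE a' x du : ℕ) : Site 2)) ((Λ.rE a' x du : ℕ) : Site 2)).filter
    fun z => ∀ w, w ∈ graphBall G w₀ (Λ.rE a' x du) → pr.frame φ w₀ du.1 b w = z → pr.ψ φ w₀ w ∈ P.farASS₂ x du j

/-- **The face step of `cond_j` as a window target step over the face frame**: depth `rE_{a'}(x, du)`, source box `[loNS, hiNS]`, planar region
`DplNS`, target `M_{a'}(x + du) ∪ Rim` (`Rim` = the region beyond depth `rM_{a'}(x + du) − L'`), levels `[M + 1, Rlev]`, source `w₀`.
[cite: KozmaNitzan2024, §4 p. 30 (Step III)] -/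
def faceStepWNS (a' : ℕ) (x : Site 2) (du : MDir) (j : ℕ) (pc : ℤ) (aw Rlev N M L' : ℕ) (Sfin : Finset V) : WinStepData V where
  Rπ := Λ.rE a' x du
  lo := loNS P x du j pc aw
  hi := hiNS P x du j pc aw
  Dpl := DplNS G pr φ P w₀ Λ b a' x du j pc aw Rlev
  T := (cellGeomSG₂S G (pr.ψ φ w₀) P w₀ Λ).M a' (x + stepVec du) ∪
    (Win G (pr.frame φ w₀ du.1 b) w₀ (DplNS G pr φ P w₀ Λ b a' x du j pc aw Rlev) (Λ.rE a' x du)).filter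
      fun v => v ∉ graphBall G w₀ (Λ.rM a' (x + stepVec du) - L')
  Rlev := Rlev
  N := N
  j₀ := M + 1
  j₁ := Rlev
  root := w₀
  Sfin := Sfin

section Clauses

variable (a' : ℕ) (x : Site 2) (du : MDir) (j : ℕ) (pc : ℤ) (aw Rlev N M L' : ℕ) (Sfin : Finset V)

/-- The region of the face step is the frame window over `DplNS`. [folklore] -/
theorem faceStepWN_RgS : stepRg G (pr.frame φ w₀ du.1 b) (faceStepWNS G pr φ P w₀ Λ b a' x du j pc aw Rlev N M L' Sfin) =
    Win G (pr.frame φ w₀ du.1 b) w₀ (DplNS G pr φ P w₀ Λ b a' x du j pc aw Rlev) (Λ.rE a' x du) := rfl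

/-- The source of the face step is the root. [folklore] -/
theorem faceStepWN_rootS : (faceStepWNS G pr φ P w₀ Λ b a' x du j pc aw Rlev N M L' Sfin).root = w₀ := rfl

/-- The target of the face step. [folklore] -/
theorem faceStepWN_TS : (faceStepWNS G pr φ P w₀ Λ b a' x du j pc aw Rlev N M L' Sfin).T =
    (cellGeomSG₂S G (pr.ψ φ w₀) P w₀ Λ).M a' (x + stepVec du) ∪
      (stepRg G (pr.frame φ w₀ du.1 b) (faceStepWNS G pr φ P w₀ Λ b a' x du j pc aw Rlev N M L' Sfin)).filter
        fun v => v ∉ graphBall G w₀ (Λ.rM a' (x + stepVec du) - L') := rfl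

/-- **The region lies in the cell-map face window** `Win ψ w₀ (farASS₂ x du j) rE` (semantic: a vertex of the region is one of "its" vertices).
[this work] -/
theorem stepRgN_subset_WinS : stepRg G (pr.frame φ w₀ du.1 b) (faceStepWNS G pr φ P w₀ Λ b a' x du j pc aw Rlev N M L' Sfin) ⊆
    Win G (pr.ψ φ w₀) w₀ (P.farASS₂ x du j) (Λ.rE a' x du) := by
  intro w hw
  rw [faceStepWN_RgS, mem_Win] at hw
  obtain ⟨hb, hD⟩ := hw
  exact (mem_Win G _).2 ⟨hb, (Finset.mem_filter.1 hD).2 w hb rfl⟩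

variable {pr b x du j} in
/-- **A vertex whose frame point is cell-controlled lies in the region**: `w ∈ B_G(w₀, rE)` and every vertex with `w`'s cell level and cell
transverse coordinate within `k₀` of `w`'s maps into `farAS₂` ⟹ `w ∈ Rg` (drift of one frame point, `rdN ≤ rdK·k₀`). [this work] -/
theorem mem_stepRgN_of_cellsS (hlipF : Lip G (pr.frame φ w₀ du.1 b)) (hc₀ : 0 < pr.c₀) (hc₁ : 0 < pr.c₁) (hD : 0 < pr.D)
    (hnz : pr.lvGen du.1 b ≠ 0) {k₀ : ℤ} (hk₀ : pr.rdN du.1 b ≤ pr.rdK du.1 b * k₀) {w : V} (hw : w ∈ graphBall G w₀ (Λ.rE a' x du))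
    (hcell : ∀ w', pr.ψ φ w₀ w' du.1 = pr.ψ φ w₀ w du.1 → |pr.ψ φ w₀ w' (oth du.1) - pr.ψ φ w₀ w (oth du.1)| ≤ k₀ →
      pr.ψ φ w₀ w' ∈ P.farASS₂ x du j) :
    w ∈ stepRg G (pr.frame φ w₀ du.1 b) (faceStepWNS G pr φ P w₀ Λ b a' x du j pc aw Rlev N M L' Sfin) := by
  rw [faceStepWN_RgS, mem_Win]
  refine ⟨hw, Finset.mem_filter.2 ⟨Finset.mem_union_right _ (pr.frame_mem_Icc hlipF hD hw), fun w' _ hf => ?_⟩⟩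
  have h := pr.read_oth_of_frame_eq w₀ hc₀ hc₁ hD du.1 b hnz hf hk₀
  exact hcell w' h.1 h.2

variable {pr b x du j} in
/-- **A cell-map window over a planar set whose transverse `k₀`-thickening (at fixed level) lies in `farAS₂` is inside the region** (the habitat of
the inner route, read in cells). [this work] -/
theorem Win_subset_stepRgNS (hlipF : Lip G (pr.frame φ w₀ du.1 b)) (hc₀ : 0 < pr.c₀) (hc₁ : 0 < pr.c₁) (hD : 0 < pr.D)
    (hnz : pr.lvGen du.1 b ≠ 0) {k₀ : ℤ} (hk₀ : pr.rdN du.1 b ≤ pr.rdK du.1 b * k₀) {Pl : Finset (Site 2)}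
    (hPl : ∀ z ∈ Pl, ∀ z' : Site 2, z' du.1 = z du.1 → |z' (oth du.1) - z (oth du.1)| ≤ k₀ → z' ∈ P.farASS₂ x du j) {R : ℕ}
    (hR : R ≤ Λ.rE a' x du) :
    Win G (pr.ψ φ w₀) w₀ Pl R ⊆ stepRg G (pr.frame φ w₀ du.1 b) (faceStepWNS G pr φ P w₀ Λ b a' x du j pc aw Rlev N M L' Sfin) := by
  intro w hw
  obtain ⟨hb, hP⟩ := (mem_Win G _).1 hw
  exact mem_stepRgN_of_cellsS G φ P w₀ Λ a' pc aw Rlev N M L' Sfin hlipF hc₀ hc₁ hD hnz hk₀ (graphBall_mono G w₀ hR hb)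
    fun w' h1 h2 => hPl _ hP _ h1 h2

variable {pr Λ b x du j} in
/-- **`M_{a'}(x + du) ⊆ Rg`** (`j ≤ K`, `rM ≤ rE`, `3r⊥ + k₀ + 3 ≤ 5r⊥`): the true target's cells thickened by the drift stay in `farAS₂`.
[cite: KozmaNitzan2024, §4 Lemma 10 (p. 17: T ⊆ D)] -/
theorem M_subset_stepRgNS (hW : WF2 P.toPCells2 Λ) (_hj : j ≤ P.K) (hlipF : Lip G (pr.frame φ w₀ du.1 b)) (hc₀ : 0 < pr.c₀) (hc₁ : 0 < pr.c₁)
    (hD : 0 < pr.D) (hnz : pr.lvGen du.1 b ≠ 0) {k₀ : ℤ} (hk₀ : pr.rdN du.1 b ≤ pr.rdK du.1 b * k₀)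
    (hk₀' : 3 * (P.r (oth du.1) : ℤ) + k₀ + 3 ≤ 5 * P.r (oth du.1)) :
    (cellGeomSG₂S G (pr.ψ φ w₀) P w₀ Λ).M a' (x + stepVec du) ⊆
      stepRg G (pr.frame φ w₀ du.1 b) (faceStepWNS G pr φ P w₀ Λ b a' x du j pc aw Rlev N M L' Sfin) := by
  change VWin G (pr.ψ φ w₀) w₀ (P.M (x + stepVec du)) (Λ.rM a' (x + stepVec du)) ⊆ _
  refine (VWin_subset_Win w₀ _ _).trans (Win_subset_stepRgNS G φ P w₀ Λ a' pc aw Rlev N M L' Sfin hlipF hc₀ hc₁ hD hnz hk₀ ?_ (hW.ME a' x du))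
  intro z hz z' h1 h2
  have hb := P.bounds_of_mem_farASS₂ (P.M_add_stepVec_subset_farASS₂ x du j hz)
  have h17 := P.lev_ge_of_mem_M_add hz
  have hr17 : (1 : ℤ) ≤ P.r du.1 := by exact_mod_cast P.one_le_r du.1
  rw [PCells2S.M, P.mem_aboxS_iff] at hz
  have hzt := hz (oth du.1)
  push_cast at hzt
  have hlev : P.lev du x z' = P.lev du x z := by unfold PCells2S.lev; rw [h1]
  refine P.mem_farASS₂_of_bounds_far (by rw [hlev]; omega) (by rw [hlev]; exact hb.2.1) (abs_le.2 ⟨?_, ?_⟩) <;>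
    [linarith [(abs_le.1 h2).1, hzt.1]; linarith [(abs_le.1 h2).2, hzt.2]]

variable {pr Λ b x du j} in
/-- **`T ⊆ Rg`.** [cite: KozmaNitzan2024, §4 Lemma 10 (p. 17: T ⊆ D)] -/
theorem faceStepWN_T_subset_RgS (hW : WF2 P.toPCells2 Λ) (hj : j ≤ P.K) (hlipF : Lip G (pr.frame φ w₀ du.1 b)) (hc₀ : 0 < pr.c₀) (hc₁ : 0 < pr.c₁)
    (hD : 0 < pr.D) (hnz : pr.lvGen du.1 b ≠ 0) {k₀ : ℤ} (hk₀ : pr.rdN du.1 b ≤ pr.rdK du.1 b * k₀)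
    (hk₀' : 3 * (P.r (oth du.1) : ℤ) + k₀ + 3 ≤ 5 * P.r (oth du.1)) :
    (faceStepWNS G pr φ P w₀ Λ b a' x du j pc aw Rlev N M L' Sfin).T ⊆
      stepRg G (pr.frame φ w₀ du.1 b) (faceStepWNS G pr φ P w₀ Λ b a' x du j pc aw Rlev N M L' Sfin) :=
  Finset.union_subset (M_subset_stepRgNS G φ P w₀ a' pc aw Rlev N M L' Sfin hW hj hlipF hc₀ hc₁ hD hnz hk₀ hk₀') (Finset.filter_subset _ _)

/-- `T ∖ M_{a'}(x + du)` lies in the rim. [folklore] -/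
theorem faceStepWN_T_sdiff_subsetS :
    (faceStepWNS G pr φ P w₀ Λ b a' x du j pc aw Rlev N M L' Sfin).T \ (cellGeomSG₂S G (pr.ψ φ w₀) P w₀ Λ).M a' (x + stepVec du) ⊆
      (stepRg G (pr.frame φ w₀ du.1 b) (faceStepWNS G pr φ P w₀ Λ b a' x du j pc aw Rlev N M L' Sfin)).filter
        fun v => v ∉ graphBall G w₀ (Λ.rM a' (x + stepVec du) - L') := by
  intro t ht
  obtain ⟨ht1, ht2⟩ := Finset.mem_sdiff.1 ht
  rcases Finset.mem_union.1 ht1 with h' | h'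
  · exact absurd h' ht2
  · exact h'

variable {pr b x du j pc aw Rlev} in
/-- **The planar enclosure of the levels**: `[loNS − (Rlev+1), hiNS + (Rlev+1)] ⊆ DplNS` — a vertex whose frame point lies in the enlarged face box
has raw coordinate within `aw + Rlev + 1` and cell level within `Rlev + 1` of the reference vertex `yF`, so (forward reading) cell transverse
coordinate within `kF` of the column centre; with `kF + 3 ≤ 5r⊥`, `j + 1 ≤ K`, `Rlev + 4 ≤ 10 s∥` and `Rlev + 4 ≤ 3 r⊥` its cell point is in
`farAS₂`. [cite: KozmaNitzan2024, §4 Lemma 10 (p. 17: B⟨R+1⟩ ⊆ D), p. 30] -/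
theorem faceStepWN_enclS {yF : V} (hyF : pr.ψ φ w₀ yF = P.faceCen x du j) (hpc : pc = relφ φ w₀ yF b) (hj : j + 1 ≤ P.K)
    (hRlev : Rlev + 4 ≤ 10 * P.s du.1) (hRlev' : (Rlev : ℤ) + 5 + P.c du.1 ≤ 3 * P.r (oth du.1)) (hc₀ : 0 < pr.c₀) (hc₁ : 0 < pr.c₁) (hD : 0 < pr.D)
    (hnz : pr.lvGen du.1 b ≠ 0) {kF : ℤ}
    (hroom : pr.Mabs * (aw + Rlev + 1) + pr.rdN du.1 b * (Rlev + 2) * pr.D ≤ pr.rdK du.1 b * kF * pr.D)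
    (hkF : kF + 3 + P.c du.1 ≤ 5 * P.r (oth du.1)) (N M L' : ℕ) (Sfin : Finset V) :
    let Q := faceStepWNS G pr φ P w₀ Λ b a' x du j pc aw Rlev N M L' Sfin
    Finset.Icc (Q.lo - ((Q.Rlev + 1 : ℕ) : Site 2)) (Q.hi + ((Q.Rlev + 1 : ℕ) : Site 2)) ⊆ Q.Dpl := by
  intro Q z hz
  refine Finset.mem_filter.2 ⟨Finset.mem_union_left _ hz, fun w hw hf => ?_⟩
  rw [Finset.mem_Icc] at hz
  have hzlo := hz.1
  have hzhi := hz.2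
  -- the frame coordinates of `w`
  have hI : pr.ψ φ w₀ w du.1 = z du.1 := by rw [← pr.frame_apply_lv φ w₀ du.1 b w, hf]
  have hb' : relφ φ w₀ w b = z (oth du.1) := by rw [← pr.frame_apply_raw φ w₀ du.1 b w, hf]
  have hl1 := hzlo du.1
  have hl2 := hzhi du.1
  have hr1 := hzlo (oth du.1)
  have hr2 := hzhi (oth du.1)
  simp only [Q, faceStepWNS, loNS, hiNS, Pi.sub_apply, Pi.add_apply, Pi.natCast_apply, if_true, if_neg (oth_ne du.1)] at hl1 hl2 hr1 hr2
  rw [← P.faceLo_fst_eq_faceHi_fst] at hl2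
  -- against the reference vertex
  have hyI : pr.ψ φ w₀ yF du.1 = P.faceLo x du j du.1 := by rw [hyF, P.faceCen_apply_fst]
  have hyO : pr.ψ φ w₀ yF (oth du.1) = P.cenS x (oth du.1) := by rw [hyF, P.faceCen_apply_oth]
  have ha : |relφ φ w₀ w b - relφ φ w₀ yF b| ≤ aw + Rlev + 1 := by
    rw [hb', ← hpc]; push_cast at hr1 hr2; exact abs_le.2 ⟨by linarith, by linarith⟩
  have hd : |pr.ψ φ w₀ w du.1 - pr.ψ φ w₀ yF du.1| ≤ Rlev + 1 := by
    rw [hI, hyI]; push_cast at hl1 hl2; exact abs_le.2 ⟨by linarith, by linarith⟩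
  have hk := pr.read_oth w₀ hc₀ hc₁ hD du.1 b hnz ha hd (k := kF) (by linarith)
  rw [hyO] at hk
  -- the level bounds from the auxiliary point `(z ∥, cen ⊥)` of the `(Rlev+1)`-enlarged face row
  set zaux : Site 2 := fun k => if k = du.1 then z du.1 else P.cenS x k with hzaux
  have hzaux_mem : zaux ∈ Finset.Icc (P.faceLo x du j - ((Rlev + 1 : ℕ) : Site 2)) (P.faceHi x du j + ((Rlev + 1 : ℕ) : Site 2)) := by
    rw [Finset.mem_Icc]
    have hr := P.one_le_r (oth du.1)
    constructor <;> intro k <;> by_cases hk' : k = du.1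
    · subst hk'; simp only [hzaux, if_true, Pi.sub_apply, Pi.natCast_apply]; exact hl1
    · rw [eq_oth_of_ne hk']
      simp only [hzaux, if_neg (oth_ne du.1), Pi.sub_apply, Pi.natCast_apply, PCells2S.faceLo, sLo]; push_cast; linarith
    · subst hk'; simp only [hzaux, if_true, Pi.add_apply, Pi.natCast_apply]; rw [← P.faceLo_fst_eq_faceHi_fst]; exact hl2
    · rw [eq_oth_of_ne hk']
      simp only [hzaux, if_neg (oth_ne du.1), Pi.add_apply, Pi.natCast_apply, PCells2S.faceHi, sHi]; push_cast; linarith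
  have hzaux_far := P.faceRow_enlarge_subset_farASS₂ x du hj (by omega) (by push_cast; omega) hzaux_mem
  have hbd := P.bounds_of_mem_farASS₂ hzaux_far
  have hlev : P.lev du x (pr.ψ φ w₀ w) = P.lev du x zaux := by unfold PCells2S.lev; rw [hI]; simp [hzaux]
  have hc0 := P.c_nonneg du.1
  have hkabs := abs_le.1 hk
  -- (R-30): below the seam the cell point is read about `cenS x`, above it about the staggered neighbour `cenS (x + du) = cenS x + σ c`
  by_cases hle : P.lev du x zaux ≤ 15 * P.r du.1
  · refine P.mem_farASS₂_of_bounds_near (by rw [hlev]; rcases hbd.1 with h | h <;> omega) (by rw [hlev]; exact hle)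
      (abs_le.2 ⟨by linarith, by linarith⟩)
  · refine P.mem_farASS₂_of_bounds_far (by rw [hlev]; omega) (by rw [hlev]; exact hbd.2.1) ?_
    rw [P.cenS_add_stepVec_oth]
    rcases sgOf_sign du with hs | hs <;> rw [hs] <;> exact abs_le.2 ⟨by linarith, by linarith⟩

variable {pr Λ b x du j pc aw} in
/-- **`F^{j+1} ⊆ X_0`**: a face vertex has the face level (shared coordinate) and — inverse reading against `yF` over the face row's extents
`faceExt` — raw coordinate within `aw` of `pc`. [cite: KozmaNitzan2024, §4 p. 30 (Step III: the source box F^{j+1})] -/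
theorem Face_subset_faceStepWN_X_zeroS (hW : WF2 P.toPCells2 Λ) {yF : V} (hyF : pr.ψ φ w₀ yF = P.faceCen x du j) (hpc : pc = relφ φ w₀ yF b)
    (hM : pr.A * TwoAxis.Para.modulus pr.n pr.h pr.vα pr.vβ ≠ 0) (hc₀ : 0 < pr.c₀) (hc₁ : 0 < pr.c₁) (hD : 0 < pr.D)
    (haw : (pr.rdK 1 b * (P.faceExt du 0 + 1) + pr.rdK 0 b * (P.faceExt du 1 + 1)) * pr.D ≤ pr.Mabs * (aw + 1)) (Rlev N M L' : ℕ)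
    (Sfin : Finset V) :
    (faceDataSGS G (pr.ψ φ w₀) P w₀ Λ).Face a' x du (j + 1) ⊆
      (stepLv G (pr.frame φ w₀ du.1 b) (faceStepWNS G pr φ P w₀ Λ b a' x du j pc aw Rlev N M L' Sfin)).X 0 := by
  intro y hy
  obtain ⟨hball, hrow⟩ := (mem_Win G _).1 (Face_subset_Win_faceRow₂S P w₀ hW a' x du j hy)
  rw [stepLv_X, mem_Win]
  refine ⟨hball, ?_⟩
  have h0 : ∀ t : Site 2, t - ((0 : ℕ) : Site 2) = t := fun t => by simp
  have h0' : ∀ t : Site 2, t + ((0 : ℕ) : Site 2) = t := fun t => by simp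
  rw [h0, h0', Finset.mem_Icc]
  have hface : ∀ k, |pr.ψ φ w₀ y k - pr.ψ φ w₀ yF k| ≤ P.faceExt du k := fun k => by rw [hyF]; exact P.abs_sub_faceCen_le hrow k
  have hraw := pr.read_raw w₀ hc₀ hc₁ hD hM b (Int.natCast_nonneg aw) (hface 0) (hface 1) haw
  rw [← hpc] at hraw
  have hr := abs_le.1 hraw
  have hlv : pr.frame φ w₀ du.1 b y du.1 = pr.ψ φ w₀ y du.1 := pr.frame_apply_lv φ w₀ du.1 b y
  have hrw : pr.frame φ w₀ du.1 b y (oth du.1) = relφ φ w₀ y b := pr.frame_apply_raw φ w₀ du.1 b y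
  rw [Finset.mem_Icc] at hrow
  constructor <;> intro k <;> by_cases hk : k = du.1
  · subst hk; show loNS P x du j pc aw du.1 ≤ _; simp only [loNS, if_true]; rw [hlv]; exact hrow.1 du.1
  · rw [eq_oth_of_ne hk]; show loNS P x du j pc aw (oth du.1) ≤ _; simp only [loNS, if_neg (oth_ne du.1)]; rw [hrw]; linarith
  · subst hk; show _ ≤ hiNS P x du j pc aw du.1; simp only [hiNS, if_true]; rw [hlv]; exact hrow.2 du.1
  · rw [eq_oth_of_ne hk]; show _ ≤ hiNS P x du j pc aw (oth du.1); simp only [hiNS, if_neg (oth_ne du.1)]; rw [hrw]; linarith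

/-- The target is nonempty as soon as the true target `M_{a'}(x + du)` is. [folklore] -/
theorem faceStepWN_T_nonemptyS (hM : ((cellGeomSG₂S G (pr.ψ φ w₀) P w₀ Λ).M a' (x + stepVec du)).Nonempty) :
    (faceStepWNS G pr φ P w₀ Λ b a' x du j pc aw Rlev N M L' Sfin).T.Nonempty :=
  hM.mono Finset.subset_union_left

variable {G P w₀ Λ} in
/-- **Target nonemptiness from a reference vertex**: a vertex `y ∈ B_G(w₀, R')` of cell point `cen v` lies in the span `M_{a'}(v)` once `R' + 1 ≤ rM_{a'}(v)`
(a weak-step neighbour stays in the cube `cen v ± 1 ⊆ M v`). [cite: KozmaNitzan2024, §4 p. 26 ((29))] -/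
theorem M_nonempty_of_vertexS {ψ : V → Site 2} (hlipψ : Lip G ψ) (hws : WeakSteps G ψ) {a' : ℕ} {v : Site 2} {y : V} {R' : ℕ}
    (hy : y ∈ graphBall G w₀ R') (hyc : ψ y = P.cenS v) (hR : R' + 1 ≤ Λ.rM a' v) : ((cellGeomSG₂S G ψ P w₀ Λ).M a' v).Nonempty := by
  obtain ⟨m, hadj, -⟩ := hws y 0 1
  have hMv : ∀ s : Site 2, (∀ i, |s i - P.cenS v i| ≤ 1) → s ∈ P.M v := fun s hs => by
    rw [PCells2S.M, PCells2S.mem_aboxS_iff]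
    intro i
    have := abs_le.1 (hs i); have := P.one_le_r i
    push_cast; constructor <;> omega
  have hyM : ψ y ∈ P.M v := hMv _ fun i => by rw [hyc]; simp
  have hmM : ψ m ∈ P.M v := hMv _ fun i => by have := hlipψ hadj i; rw [hyc] at this; rw [abs_sub_comm]; exact this
  exact ⟨y, mem_VWin_of_adj hy hR hyM hadj hmM⟩

omit [DecidableEq V] [G.LocallyFinite] in
/-- **The level boxes of the face step are wide from level `M + 1` on**: every side of `[loNS − j', hiNS + j']` has length `≥ 2M + 2`. [folklore] -/
theorem loN_hiN_hwideS {M j' : ℕ} (hj' : M + 1 ≤ j') : ∀ k, (loNS P x du j pc aw - (j' : Site 2)) k + 2 * M + 2 ≤ (hiNS P x du j pc aw + (j' : Site 2)) k := by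
  intro k
  have hj'' : (M : ℤ) + 1 ≤ j' := by exact_mod_cast hj'
  simp only [loNS, hiNS, Pi.sub_apply, Pi.add_apply, Pi.natCast_apply]
  by_cases hk : k = du.1
  · subst hk; simp only [if_true]; rw [P.faceLo_fst_eq_faceHi_fst]; linarith
  · simp only [hk, if_false]; linarith

end Clauses

end Skelφ

end Summit.CriticalPhenomena.PercolationContinuityZ3.Theorems.Transplant

end
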